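import Summits.QuantumFields.YangMills.Theorems.AlphaInputsT3ACv3PerturbedPlaquette
import Literature.MathematicalPhysics.QuantumFieldTheory.Balaban1983to89.B7Prop2SpecialUnitary
import HarnessLib

/-!
# `AlphaInputsT3ACv3GlueLedger` — STRATEGY B for 2′, the (FL) row under OWNER RULING g24-№4: **THE PARTITION-OF-UNITY GLUE LEDGER** — plaquettes of a field glued from several
# candidates `U^π = e^{z_π}·U` with scalar bond weights `χ_π`, `U′ = e^{Σ_π χ_π z_π}·U`, at an ARBITRARY reference field `U` — lane `pub-balaban3d` ∕ cell `ym3-torus`,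
# seat `ym-ust-19936-w4` (g0)

WHY (cell `ym3-torus` STATUS 2026-08-28: ★w1 LEAD memo v2.1 row R9′ «glued START», this seat's CLAIM (G)).  The START of the `hLift` Newton iteration is glued from local candidates built
in stencil gauges; on overlaps two candidates differ by a discrepancy field `z_π` (`U^π_b = e^{z_π,b}U_b`) which is sup-small, and the glue interpolates in the Lie algebra with weights
`χ_π` of width one cell (w2's σ-profiles).  The plaquettes of the glued field are read through the covariant ledger of `…v3PerturbedPlaquette` with `a = Σ_π χ_π z_π`; the only new
algebra is the LEIBNIZ RULE of the covariant curl for scalar weights: the weighted sum of the covariant curls of the pieces plus an OSCILLATION term `(χ_π(bᵢ) − χ_π(b₁))·(transported z_π)`.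
* §1 ★ `covCurl_weighted_eq` (exact decomposition) and ★ `norm_covCurl_weighted_sub_le` (`‖D_U(Σχ_π z_π)(p) − Σ_π χ_π(b₁)·D_U z_π(p)‖ ≤ 3·Σ_π ω_π ζ_π`, ω_π the oscillation of χ_π over
  the four bonds of p, ζ_π the sup of z_π there).
* §2 ★★ `dist1_plaqHol_glue_le` — THE GLUE LEDGER: `dist1 U′(∂p) ≤ dist1 U(∂p) + Σ_π |χ_π(b₁)|·(dist1 U^π(∂p) + dist1 U(∂p) + (e^{4ζ_π}−1−4ζ_π)) + 3Σ_π ω_π ζ_π + (e^{4δ}−1−4δ)`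
  (δ ≥ ‖Σ_πχ_π z_π‖ on p's bonds): plaquettes of the glued field = those of the pieces, weighted, + |dχ|·discrepancy + second order — at ANY background.
* §3 `glueData_of_near` — the discrepancy letters: for `‖U^π_b U_b* − 1‖ ≤ r ≤ 1/4` (and `|n|·r < π` for the trace), `z := mlog(U^π_b U_b*)` is skew-Hermitian, traceless, `‖z‖ ≤ 2r`, and
  `e^{z}·U_b = U^π_b` (tree: `MatrixLog.exp_mlog`, `B7Prop2Explicit.star_mlog_eq_neg`, `ExpMeanLog.trace_mlog_eq_zero`); `star_weighted_eq_neg` (real weights keep skewness).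
Count-neutral helper toward R3 2′ (items 19936∕19935); `hLift`∕(FL) NOT proved here; registry untouched; nothing about d = 4, the continuum, or a mass gap; YM₃ on T³ is rung R3, not Clay.

References: T. Bałaban, Commun. Math. Phys. 98 (1985) 17–51 [Balaban1985Averaging] ((8)–(9) pp.18–19, (19)–(20) p.21); CMP 102 (1985) 277–309 [Balaban1985Variational] ((15) p.280).
-/

set_option autoImplicit false

noncomputable section

open scoped Matrix.Norms.L2Operator BigOperators
open NormedSpace

namespace Summit.QuantumFields.YangMills.Theorems.GlueLedger

open Literature.MathematicalPhysics.QuantumFieldTheory.Balaban1983to89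
open Literature.MathematicalPhysics.QuantumFieldTheory.Balaban1983to89.MatrixLog (mlog exp_mlog norm_mlog_le_two_mul)
open Summit.QuantumFields.YangMills.Theorems.PerturbedPlaquette (dist1_SU_eq norm_conj_SU dist1_plaqHol_perturb_le norm_covCurl_le)

variable {n : Type*} [Fintype n] [DecidableEq n] {P : Params} {j : ℕ} {ι : Type*} [Fintype ι]

/-! ## §1 The covariant curl of a weighted sum: Leibniz rule and oscillation bound -/

omit [Fintype ι] in
/-- Conjugation commutes with real-weighted sums: `g·(Σ_π χ_π z_π)·g* = Σ_π χ_π·(g z_π g*)`. [folklore] -/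
theorem conj_weighted (g : Matrix n n ℂ) (s : Finset ι) (χ : ι → ℝ) (z : ι → Matrix n n ℂ) :
    g * (∑ π ∈ s, ((χ π : ℝ) : ℂ) • z π) * star g = ∑ π ∈ s, ((χ π : ℝ) : ℂ) • (g * z π * star g) := by
  rw [Finset.mul_sum, Finset.sum_mul]
  refine Finset.sum_congr rfl fun π _ => ?_
  rw [mul_smul_comm, smul_mul_assoc]

/-- **★ THE LEIBNIZ RULE OF THE COVARIANT CURL FOR SCALAR WEIGHTS** (exact): with `a_b = Σ_π χ_π(b)·z_π(b)` and the transports `Ad₁ = Ad(U₁)`, `Ad_g = Ad(U₁U₂U₃⁻¹)`, `Ad_W = Ad(U(∂p))` of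
`…v3PerturbedPlaquette`,  `D_U a(p) = Σ_π χ_π(b₁)·D_U z_π(p) + Σ_π [(χ_π(b₂)−χ_π(b₁))·Ad₁z_π(b₂) − (χ_π(b₃)−χ_π(b₁))·Ad_g z_π(b₃) − (χ_π(b₄)−χ_π(b₁))·Ad_W z_π(b₄)]`.
[cite: Balaban1985Averaging, (9) p.19] -/
theorem covCurl_weighted_eq (U₁ g W : Matrix n n ℂ) (χ : ι → PBond P j → ℝ) (z : ι → PBond P j → Matrix n n ℂ) (b₁ b₂ b₃ b₄ : PBond P j) :
    (∑ π, ((χ π b₁ : ℝ) : ℂ) • z π b₁) + U₁ * (∑ π, ((χ π b₂ : ℝ) : ℂ) • z π b₂) * star U₁ - g * (∑ π, ((χ π b₃ : ℝ) : ℂ) • z π b₃) * star g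
        - W * (∑ π, ((χ π b₄ : ℝ) : ℂ) • z π b₄) * star W =
      ∑ π, ((χ π b₁ : ℝ) : ℂ) • (z π b₁ + U₁ * z π b₂ * star U₁ - g * z π b₃ * star g - W * z π b₄ * star W) +
      ∑ π, (((χ π b₂ - χ π b₁ : ℝ) : ℂ) • (U₁ * z π b₂ * star U₁) - ((χ π b₃ - χ π b₁ : ℝ) : ℂ) • (g * z π b₃ * star g)
          - ((χ π b₄ - χ π b₁ : ℝ) : ℂ) • (W * z π b₄ * star W)) := by
  rw [conj_weighted, conj_weighted, conj_weighted, ← Finset.sum_add_distrib]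
  simp only [smul_add, smul_sub, Complex.ofReal_sub, sub_smul]
  rw [← Finset.sum_sub_distrib, ← Finset.sum_sub_distrib, ← Finset.sum_add_distrib]
  refine Finset.sum_congr rfl fun π _ => ?_
  abel

/-- **★ THE OSCILLATION BOUND**: if on the four bonds of `p` the weights oscillate by at most `ω_π` (`|χ_π(bᵢ) − χ_π(b₁)| ≤ ω_π`) and `‖z_π(bᵢ)‖ ≤ ζ_π`, then
`‖D_U(Σ_π χ_π z_π)(p) − Σ_π χ_π(b₁)·D_U z_π(p)‖ ≤ 3·Σ_π ω_π ζ_π` — for unitary transports (`U₁, g, W ∈ SU(n)`). [cite: Balaban1985Averaging, (9) p.19, (19) p.21] -/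
theorem norm_covCurl_weighted_sub_le (U₁ g W : Matrix.specialUnitaryGroup n ℂ) (χ : ι → PBond P j → ℝ) (z : ι → PBond P j → Matrix n n ℂ) (b₁ b₂ b₃ b₄ : PBond P j)
    {ω ζ : ι → ℝ} (hω₂ : ∀ π, |χ π b₂ - χ π b₁| ≤ ω π) (hω₃ : ∀ π, |χ π b₃ - χ π b₁| ≤ ω π) (hω₄ : ∀ π, |χ π b₄ - χ π b₁| ≤ ω π)
    (hζ₂ : ∀ π, ‖z π b₂‖ ≤ ζ π) (hζ₃ : ∀ π, ‖z π b₃‖ ≤ ζ π) (hζ₄ : ∀ π, ‖z π b₄‖ ≤ ζ π) :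
    ‖((∑ π, ((χ π b₁ : ℝ) : ℂ) • z π b₁) + (U₁ : Matrix n n ℂ) * (∑ π, ((χ π b₂ : ℝ) : ℂ) • z π b₂) * star (U₁ : Matrix n n ℂ)
        - (g : Matrix n n ℂ) * (∑ π, ((χ π b₃ : ℝ) : ℂ) • z π b₃) * star (g : Matrix n n ℂ) - (W : Matrix n n ℂ) * (∑ π, ((χ π b₄ : ℝ) : ℂ) • z π b₄) * star (W : Matrix n n ℂ)) -
      ∑ π, ((χ π b₁ : ℝ) : ℂ) • (z π b₁ + (U₁ : Matrix n n ℂ) * z π b₂ * star (U₁ : Matrix n n ℂ) - (g : Matrix n n ℂ) * z π b₃ * star (g : Matrix n n ℂ)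
          - (W : Matrix n n ℂ) * z π b₄ * star (W : Matrix n n ℂ))‖ ≤ 3 * ∑ π, ω π * ζ π := by
  rw [covCurl_weighted_eq, add_sub_cancel_left]
  have hterm : ∀ π, ‖((χ π b₂ - χ π b₁ : ℝ) : ℂ) • ((U₁ : Matrix n n ℂ) * z π b₂ * star (U₁ : Matrix n n ℂ))
      - ((χ π b₃ - χ π b₁ : ℝ) : ℂ) • ((g : Matrix n n ℂ) * z π b₃ * star (g : Matrix n n ℂ))
      - ((χ π b₄ - χ π b₁ : ℝ) : ℂ) • ((W : Matrix n n ℂ) * z π b₄ * star (W : Matrix n n ℂ))‖ ≤ 3 * (ω π * ζ π) := by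
    intro π
    have hω0 : 0 ≤ ω π := (abs_nonneg _).trans (hω₂ π)
    have e2 : ‖((χ π b₂ - χ π b₁ : ℝ) : ℂ) • ((U₁ : Matrix n n ℂ) * z π b₂ * star (U₁ : Matrix n n ℂ))‖ ≤ ω π * ζ π := by
      rw [norm_smul, Complex.norm_real, Real.norm_eq_abs, norm_conj_SU]
      exact mul_le_mul (hω₂ π) (hζ₂ π) (norm_nonneg _) hω0
    have e3 : ‖((χ π b₃ - χ π b₁ : ℝ) : ℂ) • ((g : Matrix n n ℂ) * z π b₃ * star (g : Matrix n n ℂ))‖ ≤ ω π * ζ π := by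
      rw [norm_smul, Complex.norm_real, Real.norm_eq_abs, norm_conj_SU]
      exact mul_le_mul (hω₃ π) (hζ₃ π) (norm_nonneg _) hω0
    have e4 : ‖((χ π b₄ - χ π b₁ : ℝ) : ℂ) • ((W : Matrix n n ℂ) * z π b₄ * star (W : Matrix n n ℂ))‖ ≤ ω π * ζ π := by
      rw [norm_smul, Complex.norm_real, Real.norm_eq_abs, norm_conj_SU]
      exact mul_le_mul (hω₄ π) (hζ₄ π) (norm_nonneg _) hω0
    calc _ ≤ ‖((χ π b₂ - χ π b₁ : ℝ) : ℂ) • ((U₁ : Matrix n n ℂ) * z π b₂ * star (U₁ : Matrix n n ℂ))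
          - ((χ π b₃ - χ π b₁ : ℝ) : ℂ) • ((g : Matrix n n ℂ) * z π b₃ * star (g : Matrix n n ℂ))‖
          + ‖((χ π b₄ - χ π b₁ : ℝ) : ℂ) • ((W : Matrix n n ℂ) * z π b₄ * star (W : Matrix n n ℂ))‖ := norm_sub_le _ _
      _ ≤ (‖((χ π b₂ - χ π b₁ : ℝ) : ℂ) • ((U₁ : Matrix n n ℂ) * z π b₂ * star (U₁ : Matrix n n ℂ))‖
          + ‖((χ π b₃ - χ π b₁ : ℝ) : ℂ) • ((g : Matrix n n ℂ) * z π b₃ * star (g : Matrix n n ℂ))‖)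
          + ‖((χ π b₄ - χ π b₁ : ℝ) : ℂ) • ((W : Matrix n n ℂ) * z π b₄ * star (W : Matrix n n ℂ))‖ := by gcongr; exact norm_sub_le _ _
      _ ≤ (ω π * ζ π + ω π * ζ π) + ω π * ζ π := by gcongr
      _ = 3 * (ω π * ζ π) := by ring
  calc _ ≤ ∑ π, ‖((χ π b₂ - χ π b₁ : ℝ) : ℂ) • ((U₁ : Matrix n n ℂ) * z π b₂ * star (U₁ : Matrix n n ℂ))
        - ((χ π b₃ - χ π b₁ : ℝ) : ℂ) • ((g : Matrix n n ℂ) * z π b₃ * star (g : Matrix n n ℂ))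
        - ((χ π b₄ - χ π b₁ : ℝ) : ℂ) • ((W : Matrix n n ℂ) * z π b₄ * star (W : Matrix n n ℂ))‖ := norm_sum_le _ _
    _ ≤ ∑ π, 3 * (ω π * ζ π) := Finset.sum_le_sum fun π _ => hterm π
    _ = 3 * ∑ π, ω π * ζ π := by rw [Finset.mul_sum]

/-- The weighted covariant curls: `‖Σ_π χ_π(b₁)·D_U z_π(p)‖ ≤ Σ_π |χ_π(b₁)|·κ_π` when `‖D_U z_π(p)‖ ≤ κ_π`. [folklore] -/
theorem norm_weighted_covCurl_le (χ : ι → PBond P j → ℝ) (D : ι → Matrix n n ℂ) (b₁ : PBond P j) {κ : ι → ℝ} (hκ : ∀ π, ‖D π‖ ≤ κ π) :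
    ‖∑ π, ((χ π b₁ : ℝ) : ℂ) • D π‖ ≤ ∑ π, |χ π b₁| * κ π := by
  refine (norm_sum_le _ _).trans (Finset.sum_le_sum fun π _ => ?_)
  rw [norm_smul, Complex.norm_real, Real.norm_eq_abs]
  exact mul_le_mul_of_nonneg_left (hκ π) (abs_nonneg _)

/-! ## §2 The glue ledger -/

/-- `‖X‖ ≤ ‖X − S‖ + ‖S‖`, packaged with two bounds. [folklore] -/
theorem norm_le_norm_add_norm_sub' {X S : Matrix n n ℂ} {A B : ℝ} (h1 : ‖X - S‖ ≤ A) (h2 : ‖S‖ ≤ B) : ‖X‖ ≤ B + A :=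
  (norm_le_insert' X S).trans (add_le_add h2 h1)


omit [Fintype n] [DecidableEq n] [Fintype ι] in
/-- Real-weighted sums of skew-Hermitian matrices are skew-Hermitian. [folklore] -/
theorem star_weighted_eq_neg (s : Finset ι) (χ : ι → ℝ) (z : ι → Matrix n n ℂ) (hz : ∀ π, star (z π) = -z π) :
    star (∑ π ∈ s, ((χ π : ℝ) : ℂ) • z π) = -∑ π ∈ s, ((χ π : ℝ) : ℂ) • z π := by
  rw [star_sum, ← Finset.sum_neg_distrib]
  refine Finset.sum_congr rfl fun π _ => ?_
  rw [star_smul, Complex.star_def, Complex.conj_ofReal, hz, smul_neg]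

/-- **★★ THE GLUE LEDGER.**  Reference field `U`, pieces `U^π` with `U^π_b = e^{z_π,b}·U_b` (`z_π,b* = −z_π,b`), scalar bond weights `χ_π`, glued field `U′_b = e^{Σ_π χ_π(b) z_π,b}·U_b`.
On a plaquette `p` with bonds `b₁,…,b₄`: weights oscillate by `≤ ω_π`, `‖z_π‖ ≤ ζ_π` on the four bonds, `‖Σ_π χ_π z_π‖ ≤ δ` there.  Then
`dist1 U′(∂p) ≤ dist1 U(∂p) + Σ_π |χ_π(b₁)|·(dist1 U^π(∂p) + dist1 U(∂p) + (e^{4ζ_π}−1−4ζ_π)) + 3Σ_π ω_π ζ_π + (e^{4δ}−1−4δ)` — the plaquettes of the glued field are those of the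
reference plus the weighted (covariant-curl readings of the) pieces' plaquettes, an oscillation × discrepancy term, and second order; ANY background. (`…PerturbedPlaquette.dist1_plaqHol_perturb_le`
for `U′`, `norm_covCurl_le` for each piece, §1.) [cite: Balaban1985Averaging, (9) p.19, (19)–(20) p.21] -/
theorem dist1_plaqHol_glue_le [Nonempty n] (U U' : GaugeField P j (Matrix.specialUnitaryGroup n ℂ)) (Uπ : ι → GaugeField P j (Matrix.specialUnitaryGroup n ℂ))
    (χ : ι → PBond P j → ℝ) (z : ι → PBond P j → Matrix n n ℂ)
    (hstar : ∀ π b, star (z π b) = -z π b)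
    (hUπ : ∀ π b, ((Uπ π b : Matrix.specialUnitaryGroup n ℂ) : Matrix n n ℂ) = exp (z π b) * (U b : Matrix n n ℂ))
    (hU' : ∀ b, ((U' b : Matrix.specialUnitaryGroup n ℂ) : Matrix n n ℂ) = exp (∑ π, ((χ π b : ℝ) : ℂ) • z π b) * (U b : Matrix n n ℂ))
    (p : Plaq P j) {ω ζ : ι → ℝ} {δ : ℝ}
    (hω₂ : ∀ π, |χ π ⟨p.src.shift p.μ, p.ν⟩ - χ π ⟨p.src, p.μ⟩| ≤ ω π) (hω₃ : ∀ π, |χ π ⟨p.src.shift p.ν, p.μ⟩ - χ π ⟨p.src, p.μ⟩| ≤ ω π)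
    (hω₄ : ∀ π, |χ π ⟨p.src, p.ν⟩ - χ π ⟨p.src, p.μ⟩| ≤ ω π)
    (hζ₁ : ∀ π, ‖z π ⟨p.src, p.μ⟩‖ ≤ ζ π) (hζ₂ : ∀ π, ‖z π ⟨p.src.shift p.μ, p.ν⟩‖ ≤ ζ π) (hζ₃ : ∀ π, ‖z π ⟨p.src.shift p.ν, p.μ⟩‖ ≤ ζ π)
    (hζ₄ : ∀ π, ‖z π ⟨p.src, p.ν⟩‖ ≤ ζ π)
    (hδ₁ : ‖∑ π, ((χ π ⟨p.src, p.μ⟩ : ℝ) : ℂ) • z π ⟨p.src, p.μ⟩‖ ≤ δ) (hδ₂ : ‖∑ π, ((χ π ⟨p.src.shift p.μ, p.ν⟩ : ℝ) : ℂ) • z π ⟨p.src.shift p.μ, p.ν⟩‖ ≤ δ)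
    (hδ₃ : ‖∑ π, ((χ π ⟨p.src.shift p.ν, p.μ⟩ : ℝ) : ℂ) • z π ⟨p.src.shift p.ν, p.μ⟩‖ ≤ δ) (hδ₄ : ‖∑ π, ((χ π ⟨p.src, p.ν⟩ : ℝ) : ℂ) • z π ⟨p.src, p.ν⟩‖ ≤ δ) :
    GaugeGroup.dist1 (GaugeField.plaqHol U' p) ≤ GaugeGroup.dist1 (GaugeField.plaqHol U p) +
      ∑ π, |χ π ⟨p.src, p.μ⟩| * (GaugeGroup.dist1 (GaugeField.plaqHol (Uπ π) p) + GaugeGroup.dist1 (GaugeField.plaqHol U p) + (Real.exp (4 * ζ π) - 1 - 4 * ζ π)) +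
      3 * ∑ π, ω π * ζ π + (Real.exp (4 * δ) - 1 - 4 * δ) := by
  -- names of the four bonds and the transports
  set b₁ : PBond P j := ⟨p.src, p.μ⟩
  set b₂ : PBond P j := ⟨p.src.shift p.μ, p.ν⟩
  set b₃ : PBond P j := ⟨p.src.shift p.ν, p.μ⟩
  set b₄ : PBond P j := ⟨p.src, p.ν⟩
  set a : PBond P j → Matrix n n ℂ := fun b => ∑ π, ((χ π b : ℝ) : ℂ) • z π b with ha
  have hastar : ∀ b, star (a b) = -a b := fun b => star_weighted_eq_neg _ _ _ fun π => hstar π b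
  set g : Matrix.specialUnitaryGroup n ℂ := U b₁ * U b₂ * (U b₃)⁻¹ with hg
  set W : Matrix.specialUnitaryGroup n ℂ := GaugeField.plaqHol U p with hW
  -- the ledger for the glued field
  have hP := dist1_plaqHol_perturb_le U U' a hastar hU' p hδ₁ hδ₂ hδ₃ hδ₄
  -- the covariant curls of the pieces, from their plaquettes
  have hκ : ∀ π, ‖z π b₁ + (U b₁ : Matrix n n ℂ) * z π b₂ * star (U b₁ : Matrix n n ℂ) - (g : Matrix n n ℂ) * z π b₃ * star (g : Matrix n n ℂ)
      - (W : Matrix n n ℂ) * z π b₄ * star (W : Matrix n n ℂ)‖ ≤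
      GaugeGroup.dist1 (GaugeField.plaqHol (Uπ π) p) + GaugeGroup.dist1 (GaugeField.plaqHol U p) + (Real.exp (4 * ζ π) - 1 - 4 * ζ π) :=
    fun π => norm_covCurl_le U (Uπ π) (z π) (hstar π) (hUπ π) p (hζ₁ π) (hζ₂ π) (hζ₃ π) (hζ₄ π)
  -- Leibniz + oscillation
  have hosc := norm_covCurl_weighted_sub_le (U b₁) g W χ z b₁ b₂ b₃ b₄ hω₂ hω₃ hω₄ hζ₂ hζ₃ hζ₄
  have hmain := norm_weighted_covCurl_le χ _ b₁ hκ
  -- assemble: ‖D_U a‖ ≤ ‖weighted‖ + ‖oscillation‖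
  have htri : ‖a b₁ + (U b₁ : Matrix n n ℂ) * a b₂ * star (U b₁ : Matrix n n ℂ) - (g : Matrix n n ℂ) * a b₃ * star (g : Matrix n n ℂ)
      - (W : Matrix n n ℂ) * a b₄ * star (W : Matrix n n ℂ)‖ ≤
      ∑ π, |χ π b₁| * (GaugeGroup.dist1 (GaugeField.plaqHol (Uπ π) p) + GaugeGroup.dist1 (GaugeField.plaqHol U p) + (Real.exp (4 * ζ π) - 1 - 4 * ζ π)) +
        3 * ∑ π, ω π * ζ π := by
    have := norm_le_norm_add_norm_sub' hosc hmain
    simpa only [ha] using this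
  simp only [ha] at hP htri ⊢
  linarith

/-! ## §3 The discrepancy letters -/

/-- **THE DISCREPANCY DATA OF TWO NEARBY FIELDS.**  With `A := U^π_b·U_b*` (`U^π_b, U_b ∈ SU(n)`): if `‖A − 1‖ ≤ r ≤ 1/4` and `|n|·r < π`, then `z := mlog A` satisfies `z* = −z`, `tr z = 0`,
`‖z‖ ≤ 2r` and `e^{z}·U_b = U^π_b` — so `U^π` IS the multiplicative perturbation `e^{z}·U` of the ledger, with `z ∈ 𝔰𝔲(n)` sup-small.  (`MatrixLog.exp_mlog`,
`B7Prop2Explicit.star_mlog_eq_neg`, `ExpMeanLog.trace_mlog_eq_zero`.) [cite: Balaban1985Variational, (15) p.280; Balaban1985Averaging, (20) p.21] -/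
theorem glueData_of_near [Nonempty n] (Uπb Ub : Matrix.specialUnitaryGroup n ℂ) {r : ℝ} (hr : ‖(Uπb : Matrix n n ℂ) * star (Ub : Matrix n n ℂ) - 1‖ ≤ r)
    (hr4 : r ≤ 1 / 4) (hπ : (Fintype.card n : ℝ) * r < Real.pi) :
    star (mlog ((Uπb : Matrix n n ℂ) * star (Ub : Matrix n n ℂ))) = -mlog ((Uπb : Matrix n n ℂ) * star (Ub : Matrix n n ℂ)) ∧
      (mlog ((Uπb : Matrix n n ℂ) * star (Ub : Matrix n n ℂ))).trace = 0 ∧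
      ‖mlog ((Uπb : Matrix n n ℂ) * star (Ub : Matrix n n ℂ))‖ ≤ 2 * r ∧
      exp (mlog ((Uπb : Matrix n n ℂ) * star (Ub : Matrix n n ℂ))) * (Ub : Matrix n n ℂ) = (Uπb : Matrix n n ℂ) := by
  have hA : (Uπb : Matrix n n ℂ) * star (Ub : Matrix n n ℂ) = ((Uπb * Ub⁻¹ : Matrix.specialUnitaryGroup n ℂ) : Matrix n n ℂ) := by
    rw [Submonoid.coe_mul]; rfl
  have h4 : ‖(Uπb : Matrix n n ℂ) * star (Ub : Matrix n n ℂ) - 1‖ ≤ 1 / 4 := hr.trans hr4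
  have h1 : ‖(Uπb : Matrix n n ℂ) * star (Ub : Matrix n n ℂ) - 1‖ < 1 := lt_of_le_of_lt h4 (by norm_num)
  refine ⟨?_, ?_, ?_, ?_⟩
  · -- the C⋆-algebra structure of `M_n(ℂ)` with the operator norm (all fields by instance search, as in the tree's `B10Eq44AvgRegularity`)
    letI : CStarAlgebra (Matrix n n ℂ) := {}
    have hmem : (Uπb : Matrix n n ℂ) * star (Ub : Matrix n n ℂ) ∈ unitary (Matrix n n ℂ) := by rw [hA]; exact (Uπb * Ub⁻¹).2.1
    exact B7Prop2Explicit.star_mlog_eq_neg hmem h4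
  · have hmem : (Uπb : Matrix n n ℂ) * star (Ub : Matrix n n ℂ) ∈ Matrix.specialUnitaryGroup n ℂ := by rw [hA]; exact (Uπb * Ub⁻¹).2
    exact ExpMeanLog.trace_mlog_eq_zero hmem (h4.trans (by norm_num)) (lt_of_le_of_lt (mul_le_mul_of_nonneg_left hr (Nat.cast_nonneg _)) hπ)
  · exact (norm_mlog_le_two_mul (hr.trans (hr4.trans (by norm_num)))).trans (by linarith)
  · rw [exp_mlog h1, mul_assoc, Unitary.star_mul_self_of_mem Ub.2.1, mul_one]

end Summit.QuantumFields.YangMills.Theorems.GlueLedger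

end
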